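import Summits.SmoothPoincare4.SmoothPoincare4.Theorems.SymplecticOrigamiOrigamiFoldExistenceStubOuterCleanRecognitionChartTube
import Summits.SmoothPoincare4.SmoothPoincare4.Theorems.SymplecticOrigamiOrigamiFoldExistenceStubOuterCleanRecognitionChartShells

/-!
# Stub `stub_outerCleanRecognitionChart` of line `shadow-pleats` for crux `OrigamiFoldExistence` — C:
# the angular straightening is a norm-preserving DIFFEOMORPHISM OF A THIN SHELL (item stmt-SmoothPoincare4-7844, route SymplecticOrigami; seat c3, S4''-chart worker)

Third helper file towards `stub_outerCleanRecognitionChart : OuterCleanRecognitionChart`, over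
file B (`…ChartTube`: tube coordinates `tubeW`, `tubeT`, `tubeV` of the lifted chart shadow
`λ ∘ G` near the outer fold sphere `S(0,2)` and the ANGULAR STRAIGHTENING `str D u = ‖u‖ • tubeV D u`,
norm-preserving, the identity on `S(0,2)`, smooth near it with injective differential on it)
and file C₀ (`…ChartShells`: shells `foldShell κ`, `On`-versions of the inverse function theorem
idioms).  Here (elementary point-set topology + the inverse function theorem):

* `StrShell D` (a predicate recording a good shell radius) and **`nonempty_strShell`**
  (registered helper): for some `κ ∈ (0, 1]` the shell `foldShell κ` lies in the tube domain,
  `str D` is injective on it with invertible differential, and maps EVERY SPHERE `S(0,r)`,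
  `|r - 2| < κ`, ONTO ITSELF (the image is open-and-closed in the connected sphere) — so `str D`
  is a norm-preserving diffeomorphism of the shell onto itself (`StrShell.image_foldShell`,
  `StrShell.exists_inverse`: a `C^∞` two-sided inverse `σ` on the shell, norm-preserving and
  fixing `S(0,2)`).

Injectivity on a uniform shell is the tree's point-set lemma `exists_injOn_prod_ball` (Hirsch,
Ch. 4 §5, proof of Thm. 5.1) applied to `(x, t) ↦ str ((2 + t) x)` on `S³ × ℝ`.

Sources: M. W. Hirsch, *Differential Topology* (1976), Ch. 4 §5 (proof of Thm. 5.1), Ch. 2 §1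
Ex. 7; the lead's `OuterClean-analysis-c3.md` §3.
-/

noncomputable section

-- the prescribed namespace `Summit.<P>.<Sub>.…` duplicates `SmoothPoincare4` (P = Sub)
set_option linter.dupNamespace false

open scoped Manifold ContDiff Topology RealInnerProductSpace
open Set Function Filter Metric
open Literature.Topology.FourManifolds Literature.Topology.FourManifolds.SphereHypersurfaceSides

namespace Summit.SmoothPoincare4.SmoothPoincare4.Theorems.OrigamiFoldExistence.ShadowPleats

/-! ### Good shells for the angular straightening -/

section Shell

variable {G : EuclideanSpace ℝ (Fin 4) → EuclideanSpace ℝ (Fin 4)} (D : TubeData (liftS4 ∘ radialSphere G 2))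

/-- A GOOD SHELL for the angular straightening `str D` of tube data `D` (explicit data, like the
tree's `TubeData`: a radius with its properties, not a named fact): `0 < κ ≤ 1`, the shell lies
in the tube domain, `str D` is injective on it with injective differential, and maps every
sphere `S(0,r)`, `|r - 2| < κ`, onto itself.  Inhabited for smooth `G` (`nonempty_strShell`). -/
structure StrShell where
  /-- the radius of the shell -/
  κ : ℝ
  /-- the radius is positive -/
  pos : 0 < κ
  /-- the radius is at most `1` -/
  le_one : κ ≤ 1
  /-- the shell lies in the tube domain -/
  subset_tubeDom : foldShell κ ⊆ tubeDom D
  /-- `str D` is injective on the shell -/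
  injOn : InjOn (str D) (foldShell κ)
  /-- `str D` has injective differential on the shell -/
  injective_fderiv : ∀ u ∈ foldShell κ, Injective (fderiv ℝ (str D) u)
  /-- `str D` maps every sphere of the shell onto itself -/
  image_sphere : ∀ r : ℝ, 2 - κ < r → r < 2 + κ → str D '' Metric.sphere 0 r = Metric.sphere 0 r

/-- The INVERSE of the angular straightening on the shell of radius `κ` (meaningful for a good
radius, `StrShell D`). -/
def strInv (κ : ℝ) : EuclideanSpace ℝ (Fin 4) → EuclideanSpace ℝ (Fin 4) := invFunOn (str D) (foldShell κ)

/-- The set of good points: in the tube domain, non-zero, with invertible differential. -/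
def strGood : Set (EuclideanSpace ℝ (Fin 4)) :=
  {u | u ∈ tubeDom D ∧ u ≠ 0 ∧ (fderiv ℝ (str D) u).det ≠ 0}

/-- The good set is open (the determinant of the continuous differential is continuous). -/
theorem isOpen_strGood (hG : ContDiff ℝ ∞ G) : IsOpen (strGood D) := by
  have hO : IsOpen (tubeDom D ∩ {u : EuclideanSpace ℝ (Fin 4) | u ≠ 0}) :=
    (isOpen_tubeDom D hG.continuous).inter isOpen_ne
  have hcont : ContinuousOn (fun u => (fderiv ℝ (str D) u).det) (tubeDom D ∩ {u | u ≠ 0}) :=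
    ContinuousLinearMap.continuous_det.comp_continuousOn
      ((contDiffOn_str D hG).continuousOn_fderiv_of_isOpen hO (by simp))
  have : strGood D = (tubeDom D ∩ {u | u ≠ 0}) ∩ (fun u => (fderiv ℝ (str D) u).det) ⁻¹' {0}ᶜ := by
    ext u; simp only [strGood, mem_setOf_eq, mem_inter_iff, mem_preimage, mem_compl_iff,
      mem_singleton_iff, and_assoc]
  rw [this]
  exact hcont.isOpen_inter_preimage hO isOpen_compl_singleton

/-- The fold sphere consists of good points. -/
theorem mem_strGood_of_norm (hG : ContDiff ℝ ∞ G) {u : EuclideanSpace ℝ (Fin 4)} (hu : ‖u‖ = 2) :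
    u ∈ strGood D :=
  ⟨mem_tubeDom_of_norm D hu, by rw [← norm_ne_zero_iff, hu]; norm_num,
    Literature.Topology.FourManifolds.det_ne_zero_of_injective (injective_fderiv_str D hG hu)⟩

/-- On the good set `str D` is `C^∞`. -/
theorem contDiffOn_str_strGood (hG : ContDiff ℝ ∞ G) : ContDiffOn ℝ ∞ (str D) (strGood D) :=
  (contDiffOn_str D hG).mono fun _ hu => ⟨hu.1, hu.2.1⟩

/-- On the good set `str D` has injective differential. -/
theorem injective_fderiv_of_mem_strGood {u : EuclideanSpace ℝ (Fin 4)} (hu : u ∈ strGood D) :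
    Injective (fderiv ℝ (str D) u) := by
  intro a b hab
  have hE : ∀ v, (fderiv ℝ (str D) u).toContinuousLinearEquivOfDetNeZero hu.2.2 v = fderiv ℝ (str D) u v :=
    fun v => ContinuousLinearMap.toContinuousLinearEquivOfDetNeZero_apply _ _ v
  exact ((fderiv ℝ (str D) u).toContinuousLinearEquivOfDetNeZero hu.2.2).injective (by rw [hE, hE]; exact hab)

/-- **`str D` is injective on some shell** (the tree's `exists_injOn_prod_ball` applied to
`(x, t) ↦ str ((2 + t) x)` on `S³ × ℝ`, clamped into a shell of good points). [folklore] -/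
theorem exists_injOn_str_foldShell (hG : ContDiff ℝ ∞ G) {κ₁ : ℝ} (hκ₁ : 0 < κ₁) (hκ₁1 : κ₁ ≤ 1)
    (hgood : foldShell κ₁ ⊆ strGood D) : ∃ κ : ℝ, 0 < κ ∧ κ ≤ κ₁ ∧ InjOn (str D) (foldShell κ) := by
  -- the clamped radial parametrisation of the shell by `S³ × ℝ`
  set cl : ℝ → ℝ := fun t => max (-(κ₁ / 2)) (min t (κ₁ / 2)) with hcl
  have hcl_cont : Continuous cl := continuous_const.max (continuous_id.min continuous_const)
  have hcl_le : ∀ t, |cl t| ≤ κ₁ / 2 := fun t => by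
    rw [abs_le]; exact ⟨le_max_left _ _, max_le (by linarith) (min_le_right _ _)⟩
  have hcl_id : ∀ t, |t| < κ₁ / 2 → cl t = t := fun t ht => by
    rw [abs_lt] at ht
    show max (-(κ₁ / 2)) (min t (κ₁ / 2)) = t
    rw [min_eq_left ht.2.le, max_eq_right ht.1.le]
  set p : (Metric.sphere (0 : EuclideanSpace ℝ (Fin 4)) 1) × ℝ → EuclideanSpace ℝ (Fin 4) :=
    fun q => (2 + cl q.2) • (q.1 : EuclideanSpace ℝ (Fin 4)) with hp
  have hp_cont : Continuous p :=
    (continuous_const.add (hcl_cont.comp continuous_snd)).smul (continuous_subtype_val.comp continuous_fst)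
  have hp_norm : ∀ q, ‖p q‖ = 2 + cl q.2 := fun q => by
    have h2 : 0 ≤ 2 + cl q.2 := by linarith [(abs_le.1 (hcl_le q.2)).1]
    rw [hp, norm_smul, Real.norm_of_nonneg h2, norm_eq_of_mem_sphere, mul_one]
  have hp_mem : ∀ q, p q ∈ foldShell κ₁ := fun q => by
    have := abs_le.1 (hcl_le q.2)
    refine ⟨?_, ?_⟩ <;> rw [hp_norm] <;> linarith
  set g : (Metric.sphere (0 : EuclideanSpace ℝ (Fin 4)) 1) × ℝ → EuclideanSpace ℝ (Fin 4) :=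
    fun q => str D (p q) with hg
  have hg_cont : Continuous g :=
    ((contDiffOn_str_strGood D hG).continuousOn.mono hgood).comp_continuous hp_cont hp_mem
  have hg0 : ∀ x : Metric.sphere (0 : EuclideanSpace ℝ (Fin 4)) 1,
      g (x, 0) = (2 : ℝ) • (x : EuclideanSpace ℝ (Fin 4)) := fun x => by
    have h0 : cl 0 = 0 := hcl_id 0 (by rw [abs_zero]; positivity)
    have : p (x, 0) = (2 : ℝ) • (x : EuclideanSpace ℝ (Fin 4)) := by simp [hp, h0]
    rw [hg]
    show str D (p (x, 0)) = _
    rw [this, str_of_norm D]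
    rw [norm_smul, Real.norm_ofNat, norm_eq_of_mem_sphere, mul_one]
  have h0inj : Injective fun x => g (x, 0) := fun x y hxy => by
    have hxy : g (x, 0) = g (y, 0) := hxy
    rw [hg0, hg0] at hxy
    exact Subtype.ext (smul_right_injective _ (two_ne_zero (α := ℝ)) hxy)
  -- local injectivity near the zero section
  have hloc : ∀ x : Metric.sphere (0 : EuclideanSpace ℝ (Fin 4)) 1,
      ∃ U ∈ 𝓝 (x, (0 : ℝ)), InjOn g U := by
    intro x
    have hx2 : ‖(2 : ℝ) • (x : EuclideanSpace ℝ (Fin 4))‖ = 2 := by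
      rw [norm_smul, Real.norm_ofNat, norm_eq_of_mem_sphere, mul_one]
    obtain ⟨B, hB, hinjB⟩ := exists_nhds_injOn_of_fderiv (contDiffOn_str_strGood D hG) (isOpen_strGood D hG)
      (mem_strGood_of_norm D hG hx2) (injective_fderiv_str D hG hx2)
    have hpx : p (x, 0) = (2 : ℝ) • (x : EuclideanSpace ℝ (Fin 4)) := by
      have h0 : cl 0 = 0 := hcl_id 0 (by rw [abs_zero]; positivity)
      simp [hp, h0]
    have h1 : p ⁻¹' B ∈ 𝓝 (x, (0 : ℝ)) := hp_cont.continuousAt.preimage_mem_nhds (by rw [hpx]; exact hB)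
    have h2 : {q : (Metric.sphere (0 : EuclideanSpace ℝ (Fin 4)) 1) × ℝ | |q.2| < κ₁ / 2} ∈ 𝓝 (x, (0 : ℝ)) := by
      refine (isOpen_lt (continuous_abs.comp continuous_snd) continuous_const).mem_nhds ?_
      show |(0 : ℝ)| < κ₁ / 2
      rw [abs_zero]; positivity
    refine ⟨_, inter_mem h1 h2, ?_⟩
    rintro ⟨x₁, t₁⟩ ⟨hb₁, ht₁⟩ ⟨x₂, t₂⟩ ⟨hb₂, ht₂⟩ heq
    have hpeq : p (x₁, t₁) = p (x₂, t₂) := hinjB hb₁ hb₂ heq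
    have hnorm : t₁ = t₂ := by
      have := congrArg norm hpeq
      rw [hp_norm, hp_norm] at this
      simpa [hcl_id t₁ ht₁, hcl_id t₂ ht₂] using this
    subst hnorm
    have hc : (2 : ℝ) + cl t₁ ≠ 0 := by linarith [(abs_le.1 (hcl_le t₁)).1]
    have : (x₁ : EuclideanSpace ℝ (Fin 4)) = x₂ := smul_right_injective _ hc hpeq
    rw [Subtype.ext this]
  obtain ⟨ε, hε, hinj⟩ := Literature.Topology.FourManifolds.exists_injOn_prod_ball hg_cont h0inj hloc
  -- read off injectivity of `str` on the shell of radius `min ε (κ₁/2)`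
  refine ⟨min ε (κ₁ / 2), lt_min hε (by positivity), (min_le_right _ _).trans (by linarith), ?_⟩
  intro u hu v hv huv
  have key : ∀ w ∈ foldShell (min ε (κ₁ / 2)), ∃ q : (Metric.sphere (0 : EuclideanSpace ℝ (Fin 4)) 1) × ℝ,
      q ∈ (univ : Set (Metric.sphere (0 : EuclideanSpace ℝ (Fin 4)) 1)) ×ˢ ball (0 : ℝ) ε ∧ p q = w := by
    intro w hw
    have hw0 : w ≠ 0 := by
      rw [← norm_pos_iff]; linarith [hw.1, min_le_right ε (κ₁ / 2)]
    have hwn : ‖w‖ ≠ 0 := norm_ne_zero_iff.2 hw0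
    have ht : |‖w‖ - 2| < min ε (κ₁ / 2) := by
      rw [abs_lt]; constructor <;> linarith [hw.1, hw.2]
    refine ⟨(⟨‖w‖⁻¹ • w, by rw [mem_sphere_zero_iff_norm, norm_smul, norm_inv, norm_norm,
      inv_mul_cancel₀ hwn]⟩, ‖w‖ - 2), ⟨mem_univ _, ?_⟩, ?_⟩
    · rw [mem_ball_zero_iff, Real.norm_eq_abs]; exact ht.trans_le (min_le_left _ _)
    · show (2 + cl (‖w‖ - 2)) • (‖w‖⁻¹ • w) = w
      rw [hcl_id _ (ht.trans_le (min_le_right _ _)), smul_smul]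
      have : (2 + (‖w‖ - 2)) * ‖w‖⁻¹ = 1 := by field_simp; ring
      rw [this, one_smul]
  obtain ⟨qu, hqu, rfl⟩ := key u hu
  obtain ⟨qv, hqv, rfl⟩ := key v hv
  rw [hinj hqu hqv huv]

/-- **`str D` maps a sphere of good radius ONTO ITSELF**: the image is relatively open (inverse
function theorem + norm preservation) and closed (compactness) in the connected `S(0,r)`. -/
theorem image_str_sphere (hG : ContDiff ℝ ∞ G) {κ : ℝ} (hκ2 : κ ≤ 2) (hgood : foldShell κ ⊆ strGood D)
    {r : ℝ} (hr1 : 2 - κ < r) (hr2 : r < 2 + κ) : str D '' Metric.sphere 0 r = Metric.sphere 0 r := by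
  have hr0 : 0 < r := by linarith
  have hSsub : Metric.sphere (0 : EuclideanSpace ℝ (Fin 4)) r ⊆ foldShell κ := fun u hu => by
    rw [mem_sphere_zero_iff_norm] at hu; exact ⟨by rw [hu]; exact hr1, by rw [hu]; exact hr2⟩
  set A := str D '' Metric.sphere 0 r with hA
  have hAsub : A ⊆ Metric.sphere 0 r := by
    rintro _ ⟨u, hu, rfl⟩
    rw [mem_sphere_zero_iff_norm, norm_str, mem_sphere_zero_iff_norm.1 hu]
  -- closed
  have hAclosed : IsClosed A :=
    ((isCompact_sphere (0 : EuclideanSpace ℝ (Fin 4)) r).image_of_continuousOn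
      ((contDiffOn_str_strGood D hG).continuousOn.mono (hSsub.trans hgood))).isClosed
  -- relatively open: `A = U₁ ∩ S(0,r)` with `U₁ = str(shell)` open
  set U₁ := str D '' foldShell κ with hU₁
  have hU₁open : IsOpen U₁ := isOpen_image_of_injOn_fderiv (contDiffOn_str_strGood D hG) (isOpen_strGood D hG)
    (fun x hx => injective_fderiv_of_mem_strGood D hx) (isOpen_foldShell κ) hgood
  have hAU : Metric.sphere 0 r ∩ U₁ = A := by
    ext z
    constructor
    · rintro ⟨hz, b, hb, rfl⟩
      refine ⟨b, ?_, rfl⟩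
      rw [mem_sphere_zero_iff_norm, ← norm_str D b]
      exact mem_sphere_zero_iff_norm.1 hz
    · rintro ⟨u, hu, rfl⟩
      exact ⟨hAsub ⟨u, hu, rfl⟩, u, hSsub hu, rfl⟩
  -- connectedness of the sphere
  refine subset_antisymm hAsub fun z hz => ?_
  by_contra hzA
  have hpre : IsPreconnected (Metric.sphere (0 : EuclideanSpace ℝ (Fin 4)) r) :=
    isPreconnected_sphere (Module.one_lt_rank_of_one_lt_finrank
      (by rw [finrank_euclideanSpace_fin]; norm_num)) 0 r
  obtain ⟨u₀, hu₀⟩ : (Metric.sphere (0 : EuclideanSpace ℝ (Fin 4)) r).Nonempty :=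
    (NormedSpace.sphere_nonempty (E := EuclideanSpace ℝ (Fin 4))).2 hr0.le
  have hmemU : ∀ w ∈ Metric.sphere (0 : EuclideanSpace ℝ (Fin 4)) r, w ∈ A → w ∈ U₁ := fun w _ hwA => by
    have : w ∈ Metric.sphere 0 r ∩ U₁ := by rw [hAU]; exact hwA
    exact this.2
  have hcover : Metric.sphere (0 : EuclideanSpace ℝ (Fin 4)) r ⊆ U₁ ∪ Aᶜ := fun w hw => by
    by_cases h : w ∈ A
    · exact Or.inl (hmemU w hw h)
    · exact Or.inr h
  have hA₀ : str D u₀ ∈ A := ⟨u₀, hu₀, rfl⟩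
  obtain ⟨w, hw, hwU, hwA⟩ := hpre U₁ Aᶜ hU₁open hAclosed.isOpen_compl hcover
    ⟨str D u₀, hAsub hA₀, hmemU _ (hAsub hA₀) hA₀⟩ ⟨z, hz, hzA⟩
  have : w ∈ A := by rw [← hAU]; exact ⟨hw, hwU⟩
  exact hwA this

/-- **GOOD SHELLS EXIST** for the angular straightening of the tube data of the lifted crease
of any smooth chart shadow `G` (registered helper of file C). [folklore] -/
theorem nonempty_strShell (hG : ContDiff ℝ ∞ G) : Nonempty (StrShell D) := by
  obtain ⟨κ₁, hκ₁, hκ₁1, hgood⟩ := exists_foldShell_subset (isOpen_strGood D hG)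
    fun u hu => mem_strGood_of_norm D hG (mem_sphere_zero_iff_norm.1 hu)
  obtain ⟨κ, hκ, hκle, hinj⟩ := exists_injOn_str_foldShell D hG hκ₁ hκ₁1 hgood
  have hgood' : foldShell κ ⊆ strGood D := (foldShell_mono hκle).trans hgood
  exact ⟨⟨κ, hκ, hκle.trans hκ₁1, fun u hu => (hgood' hu).1, hinj,
    fun u hu => injective_fderiv_of_mem_strGood D (hgood' hu),
    fun r hr1 hr2 => image_str_sphere D hG (by linarith [hκle.trans hκ₁1]) hgood' hr1 hr2⟩⟩

namespace StrShell

variable {D} (h : StrShell D)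

/-- A good shell radius is at most `2`. -/
theorem le_two : h.κ ≤ 2 := h.le_one.trans one_le_two

/-- A smaller positive radius is again good. -/
def shrink {κ' : ℝ} (hκ' : 0 < κ') (hle : κ' ≤ h.κ) : StrShell D :=
  ⟨κ', hκ', hle.trans h.le_one, (foldShell_mono hle).trans h.subset_tubeDom, h.injOn.mono (foldShell_mono hle),
    fun u hu => h.injective_fderiv u (foldShell_mono hle hu),
    fun r hr1 hr2 => h.image_sphere r (by linarith) (by linarith)⟩

/-- The radius of a shrunk shell. -/
@[simp] theorem shrink_κ {κ' : ℝ} (hκ' : 0 < κ') (hle : κ' ≤ h.κ) : (h.shrink hκ' hle).κ = κ' := rfl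

/-- Points of a good shell are non-zero. -/
theorem ne_zero {u : EuclideanSpace ℝ (Fin 4)} (hu : u ∈ foldShell h.κ) : u ≠ 0 :=
  ne_zero_of_mem_foldShell h.le_two hu

/-- `str D` is `C^∞` on a good shell. -/
theorem contDiffOn (hG : ContDiff ℝ ∞ G) : ContDiffOn ℝ ∞ (str D) (foldShell h.κ) :=
  (contDiffOn_str D hG).mono fun _ hu => ⟨h.subset_tubeDom hu, h.ne_zero hu⟩

/-- `str D` maps a shell into itself. -/
theorem mapsTo : MapsTo (str D) (foldShell h.κ) (foldShell h.κ) := fun u hu =>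
  (mem_foldShell_iff_of_norm_eq (norm_str D u)).2 hu

/-- **`str D` maps a good shell ONTO itself.** -/
theorem image_foldShell : str D '' foldShell h.κ = foldShell h.κ := by
  refine subset_antisymm (h.mapsTo.image_subset) fun v hv => ?_
  have : v ∈ str D '' Metric.sphere 0 ‖v‖ := by
    rw [h.image_sphere ‖v‖ hv.1 hv.2]; exact mem_sphere_zero_iff_norm.2 rfl
  obtain ⟨u, hu, huv⟩ := this
  exact ⟨u, (mem_foldShell_iff_of_norm_eq (mem_sphere_zero_iff_norm.1 hu)).2 hv, huv⟩

/-- Every point of a good shell is the straightening of a point of the same norm. -/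
theorem exists_eq_str {v : EuclideanSpace ℝ (Fin 4)} (hv : v ∈ foldShell h.κ) :
    ∃ u ∈ foldShell h.κ, str D u = v := by
  have : v ∈ str D '' foldShell h.κ := by rw [h.image_foldShell]; exact hv
  exact this

/-- The image of a good shell under `str D` is open. -/
theorem isOpen_image (hG : ContDiff ℝ ∞ G) {B : Set (EuclideanSpace ℝ (Fin 4))} (hB : IsOpen B)
    (hBs : B ⊆ foldShell h.κ) : IsOpen (str D '' B) :=
  isOpen_image_of_injOn_fderiv (h.contDiffOn hG) (isOpen_foldShell h.κ) h.injective_fderiv hB hBs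

/-- **The inverse straightening is a left inverse on a good shell.** -/
theorem strInv_str {u : EuclideanSpace ℝ (Fin 4)} (hu : u ∈ foldShell h.κ) : strInv D h.κ (str D u) = u :=
  h.injOn.leftInvOn_invFunOn hu

/-- The inverse straightening maps a good shell into itself and is a right inverse there. -/
theorem str_strInv {v : EuclideanSpace ℝ (Fin 4)} (hv : v ∈ foldShell h.κ) :
    strInv D h.κ v ∈ foldShell h.κ ∧ str D (strInv D h.κ v) = v := by
  obtain ⟨u, hu, rfl⟩ := h.exists_eq_str hv
  rw [h.strInv_str hu]
  exact ⟨hu, rfl⟩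

/-- The inverse straightening maps a good shell into itself. -/
theorem strInv_mem {v : EuclideanSpace ℝ (Fin 4)} (hv : v ∈ foldShell h.κ) : strInv D h.κ v ∈ foldShell h.κ :=
  (h.str_strInv hv).1

/-- The inverse straightening preserves norms on a good shell. -/
theorem norm_strInv {v : EuclideanSpace ℝ (Fin 4)} (hv : v ∈ foldShell h.κ) : ‖strInv D h.κ v‖ = ‖v‖ := by
  conv_rhs => rw [← (h.str_strInv hv).2]
  rw [norm_str]

/-- The inverse straightening fixes the fold sphere. -/
theorem strInv_of_norm {v : EuclideanSpace ℝ (Fin 4)} (hv : ‖v‖ = 2) : strInv D h.κ v = v := by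
  conv_lhs => rw [← str_of_norm D hv]
  exact h.strInv_str (mem_foldShell_of_norm h.pos hv)

/-- **The inverse straightening is `C^∞` on a good shell.** -/
theorem contDiffOn_strInv (hG : ContDiff ℝ ∞ G) : ContDiffOn ℝ ∞ (strInv D h.κ) (foldShell h.κ) := by
  have := contDiffOn_invFunOn (h.contDiffOn hG) (isOpen_foldShell h.κ) h.injOn h.injective_fderiv
  rwa [h.image_foldShell] at this

/-- The unit vector of a point of a good shell, read through the inverse straightening, is its
direction: `tubeV (strInv v) = v / ‖v‖`. -/
theorem tubeV_strInv {v : EuclideanSpace ℝ (Fin 4)} (hv : v ∈ foldShell h.κ) : tubeV D (strInv D h.κ v) = ‖v‖⁻¹ • v := by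
  have hv0 : v ≠ 0 := ne_zero_of_mem_foldShell h.le_two hv
  have h1 := (h.str_strInv hv).2
  rw [str, h.norm_strInv hv] at h1
  calc tubeV D (strInv D h.κ v) = ‖v‖⁻¹ • (‖v‖ • tubeV D (strInv D h.κ v)) := by
        rw [smul_smul, inv_mul_cancel₀ (norm_ne_zero_iff.2 hv0), one_smul]
    _ = ‖v‖⁻¹ • v := by rw [h1]

/-- The inverse straightening has injective differential on a good shell (chain rule on
`str ∘ strInv = id`). -/
theorem injective_fderiv_strInv (hG : ContDiff ℝ ∞ G) {v : EuclideanSpace ℝ (Fin 4)} (hv : v ∈ foldShell h.κ) :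
    Injective (fderiv ℝ (strInv D h.κ) v) := by
  have hn : (∞ : WithTop ℕ∞) ≠ 0 := by simp
  have hsv := h.strInv_mem hv
  have hd1 : DifferentiableAt ℝ (strInv D h.κ) v :=
    ((h.contDiffOn_strInv hG).contDiffAt ((isOpen_foldShell h.κ).mem_nhds hv)).differentiableAt hn
  have hd2 : DifferentiableAt ℝ (str D) (strInv D h.κ v) :=
    ((h.contDiffOn hG).contDiffAt ((isOpen_foldShell h.κ).mem_nhds hsv)).differentiableAt hn
  have heq : str D ∘ strInv D h.κ =ᶠ[𝓝 v] id :=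
    Filter.eventually_of_mem ((isOpen_foldShell h.κ).mem_nhds hv) fun w hw => (h.str_strInv hw).2
  have hcomp : fderiv ℝ (str D ∘ strInv D h.κ) v = (fderiv ℝ (str D) (strInv D h.κ v)).comp (fderiv ℝ (strInv D h.κ) v) :=
    fderiv_comp v hd2 hd1
  rw [heq.fderiv_eq, fderiv_id] at hcomp
  intro a b hab
  have := congrArg (fderiv ℝ (str D) (strInv D h.κ v)) hab
  rw [← ContinuousLinearMap.comp_apply, ← ContinuousLinearMap.comp_apply, ← hcomp] at this
  exact this

end StrShell

end Shell

end Summit.SmoothPoincare4.SmoothPoincare4.Theorems.OrigamiFoldExistence.ShadowPleats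

end
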